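import Mathlib
import Summits.ResolutionOfSingularities.ResolutionOfSingularities.Theorems.WeightedInvariantLocalWeightedDropWildMonicFlagDropKangaroo
import Summits.ResolutionOfSingularities.ResolutionOfSingularities.Theorems.WeightedInvariantLocalWeightedDropWildMonicFlagDropKangarooSplit
import Summits.ResolutionOfSingularities.ResolutionOfSingularities.Theorems.WeightedInvariantLocalWeightedDropWildMonicFlagSwapReading
import Summits.ResolutionOfSingularities.ResolutionOfSingularities.Theorems.WeightedInvariantLocalWeightedDropWildMonicFlagDropShear

/-!
# `WeightedInvariant.LocalWeightedDrop`, line `hasse-ridge-face-selection`, S3ρ flag line: Uk-ρD3 (t ≠ 0) — `DropKangarooTangent` FROM ITS PACKAGE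

Crux item stmt-ResolutionOfSingularities-8899 `LocalWeightedDrop` (route `ResolutionOfSingularities/WeightedInvariant`), engine of the door
`HypersurfaceCentreConstruction` stmt-ResolutionOfSingularities-19897.  [OURS · L1 W4.3, chain w43, seat res-type-056 (Uk-ρD3, plan-1 DEALS gen 9 #12;
res-type-083's split p518441 `…WildMonicFlagDropKangarooSplit`: the TANGENT child flags at a translated point).  MODEL: S. Perlega,
arXiv:2011.14443 Ch. 9 Prop. 9.1.4 proof, case (4) with `t ≠ 0`, `E = V(xy)` [cite: Perlega2020, Prop. 9.1.4 (4): «Set `y₁ = y − tx` … Let the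
flag `𝓕` be defined by `𝓕₂ = V(z)` and `𝓕₁ = V(z, y₁)`. Hence … `n_𝓕 = 1` if `t ≠ 0` and `E = V(xy)` … `d_𝓖 ≤ d₁ + ε ≤ d_𝓕/n_𝓖 + ε` …
`inv(𝓖) < inv(𝓕)`», with Prop. 6.2.4 (2) for `d₁ ≤ (1/n)·ord_{(y)} minit(J₂)`]; every object OURS (res-L1-w43-stub-3's flag family,
res-type-083's `DropKangarooTangent` / `IsKangarooStep`); not a statement of any manuscript [claim: Hironaka2017, status: under-review].]

THE PACKAGE `TranslatedPackageKangaroo d p k`.  For a kangaroo step `(A, E = {0,1}; t ≠ 0; T, φ′)` (child `C = shift d T φ′`, kangaroo flags read on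
`C♯ = swapT C`) and a tangency `n ≥ 2`: a parent TANGENT flag `F = (false, g₀, t·X)` (`n_𝓕 = 1`, the curve `x₂ + t x₁` through which the new
point lies) which is valid with `d_𝓕 = dFlagN d! 1 (…) > 0` (Per17 Lemma 9.1.3: `d_𝓕 = −1` would make the child terminal), a re-centring `ψ` making
`flagTuple d C♯ ψ 0` `(1,n)`-clean with finite `m`, and Prop. 6.2.4 (2) between them: `n · dInit (1,n) (…) ≤ d_𝓕`
(`…WildMonicKangarooBlowupInit.mul_dInit_image_psi_le_gammaL` on the sheared parent, with stub-5's `initHeight_one_eq_gammaL`).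
`dropKangarooTangent_of_package : TranslatedPackageKangaroo d p k → DropKangarooTangent d p k`: `d_𝓖 = dFlagN d! n (…) < d_𝓕`
(`…WildMonicKangarooFlagHeight.dFlagN_shift_lt`), so `(d_𝓖, n, 0) < (d_𝓕, 1, 0) ≤ vmax`.  `translatedPackageKangaroo_holds` (parent-side
cleaning for the sheared parent, = res-L1-w43-stub-2's Uk-ρD6 core pattern with the extra weight `(n, n+1)`) is the remaining input.
AI-written; gate-accepted means sorry-free with standard axioms, not refereed.
-/

set_option linter.dupNamespace false -- mandated namespace of this single-conjunct summit

noncomputable section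

namespace Summit.ResolutionOfSingularities.ResolutionOfSingularities.Theorems

open Literature.AlgebraicGeometry.Resolution
open Literature.AlgebraicGeometry.Resolution.HauserPerlega2024 (Triple)

namespace WildMonic

open MvPowerSeries MonicDescent
open PurePowerFlag (swap swapE orient orientE IsN0 IsTangent succE)

variable {k : Type} [Field k] {d : ℕ}

/-- THE KANGAROO PACKAGE OF A TRANSLATED STEP (see the module docstring): for every tangency `n ≥ 2`, a valid parent tangent flag
`(g₀, t·X)` with positive `d_𝓕`, a `(1,n)`-cleaning re-centring `ψ` of the swapped child, and Prop. 6.2.4 (2) between them. -/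
def TranslatedPackageKangaroo (d p : ℕ) (k : Type) [Field k] : Prop :=
  ∀ (A : Fin d → MvPowerSeries (Fin 2) k) (E : Finset (Fin 2)) (t : k) (T : Fin d → MvPowerSeries (Fin 2) k) (φ' : MvPowerSeries (Fin 2) k)
    (vmax : Triple), IsKangarooStep d p A E t T φ' vmax → ∀ n : ℕ, 2 ≤ n →
    ∃ (g₀ ψ : MvPowerSeries (Fin 2) k), constantCoeff g₀ = 0 ∧ constantCoeff ψ = 0 ∧
      IsMMax d A E g₀ (PowerSeries.C t * PowerSeries.X) ∧
      0 < dFlagN d.factorial 1 (newtonSet (flagTuple d A g₀ (PowerSeries.C t * PowerSeries.X))) ∧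
      IsWClean p ![1, n] (flagTuple d (swapT (shift d T φ')) ψ 0) ∧
      wMin ![1, n] (flagTuple d (swapT (shift d T φ')) ψ 0) ≠ ⊤ ∧
      n * dInit ![1, n] (newtonSet (flagTuple d (swapT (shift d T φ')) ψ 0)) ≤
        dFlagN d.factorial 1 (newtonSet (flagTuple d A g₀ (PowerSeries.C t * PowerSeries.X)))

/-- The shear `t·X` of the parent flag `V(y + g₀, x₂ + t x₁)`: no constant term. -/
theorem constantCoeff_C_mul_X (t : k) : PowerSeries.constantCoeff (PowerSeries.C t * PowerSeries.X : PowerSeries k) = 0 := by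
  rw [map_mul, PowerSeries.constantCoeff_X, mul_zero]

/-- … it is non-zero with order `1` for `t ≠ 0`. -/
theorem order_C_mul_X {t : k} (ht : t ≠ 0) : (PowerSeries.C t * PowerSeries.X : PowerSeries k).order = 1 := by
  have h : (PowerSeries.C t * PowerSeries.X : PowerSeries k).order = (1 : ℕ) := by
    rw [PowerSeries.order_eq_nat]
    refine ⟨?_, fun i hi => ?_⟩
    · rw [PowerSeries.coeff_C_mul, PowerSeries.coeff_one_X, mul_one]; exact ht
    · have hi0 : i = 0 := by omega
      subst hi0
      rw [PowerSeries.coeff_C_mul, PowerSeries.coeff_zero_X, mul_zero]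
  rw [h]; rfl

/-- … hence it is a tangent flag datum with `n_𝓕 = 1` when both letters are boundary. -/
theorem isTangent_C_mul_X {t : k} (ht : t ≠ 0) {E : Finset (Fin 2)} (h0 : (0 : Fin 2) ∈ E) (h1 : (1 : Fin 2) ∈ E) :
    IsTangent E (PowerSeries.C t * PowerSeries.X : PowerSeries k) := by
  refine ⟨h1, fun h => ?_, Or.inr h0⟩
  have := order_C_mul_X (k := k) ht
  rw [h, PowerSeries.order_zero] at this
  exact ENat.top_ne_coe 1 this

/-- The tangency of `t·X` is `1`. -/
theorem tangency_C_mul_X {t : k} (ht : t ≠ 0) : PurePowerFlag.tangency (PowerSeries.C t * PowerSeries.X : PowerSeries k) = 1 := by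
  unfold PurePowerFlag.tangency; rw [order_C_mul_X ht]; rfl

/-- **Uk-ρD3 (t ≠ 0): `DropKangarooTangent` FROM THE TRANSLATED KANGAROO PACKAGE** (Perlega Prop. 9.1.4 case (4), `t ≠ 0`). -/
theorem dropKangarooTangent_of_package {p : ℕ} [Fact p.Prime] [CharP k p] (hpkg : TranslatedPackageKangaroo d p k) :
    DropKangarooTangent d p k := by
  intro A E t T φ' vmax hstep g h hg hh htan h2 hmm
  classical
  obtain ⟨-, -, -, -, hvmax, ht, h0E, h1E, -, -, -, -⟩ := id hstep
  -- the flag data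
  have hh0 : h ≠ 0 := htan.2.1
  obtain ⟨hn2, hlow, hcn⟩ := order_toNat_spec hh0 h2
  set n := h.order.toNat with hn
  have htn : PurePowerFlag.tangency h = n := rfl
  have hnotN0 : ¬ IsN0 (swapE (succE t E)) h := by
    rintro (h1 | h0)
    · exact h1 htan.1
    · exact hh0 h0
  -- the package for this tangency
  obtain ⟨g₀, ψ, hg₀, hψ, hmax₀, hdpos, hclean, hfin, h624⟩ := hpkg A E t T φ' vmax hstep n hn2
  set C' := swapT (shift d T φ') with hC'
  set Astar := flagTuple d C' ψ 0 with hAstar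
  -- the child flag tuple as a shift of the sheared clean tuple
  have hψσ : constantCoeff (subst (PurePowerFlag.shift h) ψ) = 0 := constantCoeff_subst_shear hh hψ
  have htuple : flagTuple d C' g h = shift d (fun j => subst (PurePowerFlag.shift h) (Astar j)) (g - subst (PurePowerFlag.shift h) ψ) := by
    rw [hAstar, ← flagTuple_def, flagTuple_flagTuple C' ψ _ (map_zero _) hh, zero_add, add_sub_cancel]
  have htuple0 : flagTuple d C' (subst (PurePowerFlag.shift h) ψ) h = fun j => subst (PurePowerFlag.shift h) (Astar j) := by
    have h1 : flagTuple d C' (subst (PurePowerFlag.shift h) ψ) h = shift d (fun j => subst (PurePowerFlag.shift h) (Astar j)) 0 := by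
      rw [hAstar, ← flagTuple_def, flagTuple_flagTuple C' ψ _ (map_zero _) hh, zero_add, add_zero]
    rw [h1, shift_zero]
  obtain ⟨m, hm⟩ : ∃ m : ℕ, wMin ![1, n] Astar = m := ENat.ne_top_iff_exists.mp hfin |>.imp fun m hm => hm.symm
  have hval : mFlagN d.factorial n (newtonSet (fun j => subst (PurePowerFlag.shift h) (Astar j))) ≤
      mFlagN d.factorial n (newtonSet (shift d (fun j => subst (PurePowerFlag.shift h) (Astar j)) (g - subst (PurePowerFlag.shift h) ψ))) := by
    have h1 := hmm _ hψσ
    rw [mOf_of_not_isN0 hnotN0, mOf_of_not_isN0 hnotN0, htn, htuple0, htuple] at h1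
    exact h1
  -- the kangaroo bound against `d_𝓕` of the parent tangent flag `(g₀, t·X)`
  have hdrop := dFlagN_shift_lt (w := ![1, n]) (by simp) (by simp) (by omega) hlow rfl hcn Astar p hn2 hclean hm
    (g - subst (PurePowerFlag.shift h) ψ) hval hdpos h624
  rw [← htuple] at hdrop
  -- `(d_𝓖, n, 0) < (d_𝓕, 1, 0) ≤ vmax`
  have hF : IsFlagTriple d A E (flagTriple d A E g₀ (PowerSeries.C t * PowerSeries.X)) :=
    isFlagTriple_of_first hg₀ (constantCoeff_C_mul_X t) (Or.inr (isTangent_C_mul_X ht h0E h1E)) hmax₀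
  refine lt_of_lt_of_le ?_ (hvmax _ hF)
  have hnotN0F : ¬ IsN0 E (PowerSeries.C t * PowerSeries.X : PowerSeries k) := by
    rintro (h1 | h0)
    · exact h1 h1E
    · exact (isTangent_C_mul_X ht h0E h1E).2.1 h0
  rw [flagTriple_of_not_isN0 hnotN0, flagTriple_of_not_isN0 hnotN0F, htn, tangency_C_mul_X ht]
  exact Prod.Lex.toLex_lt_toLex.mpr (Or.inl hdrop)

end WildMonic

end Summit.ResolutionOfSingularities.ResolutionOfSingularities.Theorems

end
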